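import Mathlib
import Literature.Analysis.FluidPDE.KNSSTypeIIZoomIn
import Literature.Analysis.FluidPDE.KNSSBlowupLimit
import Literature.Analysis.FluidPDE.BoundedL2ClassicalMild
import Literature.Analysis.FluidPDE.OseenDuhamelLimits
import Literature.Analysis.FluidPDE.NSBoundedMildSmoothing
import Summits.NavierStokesRegularity.NavierStokesRegularity.Theorems.PlaneEnergyCeilingBoundedPlanarEnergyRegularityZoomWindowLipschitz
import Summits.NavierStokesRegularity.NavierStokesRegularity.Theorems.PlaneEnergyCeilingBoundedPlanarEnergyRegularityZoomAncientMild
import HarnessLib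

/-!
# `DSolutionBubble.TypeIISlowDoublingEternal` (item stmt-NavierStokesRegularity-4064) — tools:
# the ETERNAL extraction of a two-sided KNSS zoom

Helper file for the support item `Theses.DSolutionBubble.TypeIISlowDoublingEternal` (Type II ⇒
bounded eternal zoom limit). KNSS 2009's zoom-in (§6, Lemma 6.1) extracts an ANCIENT limit from
rescaled solutions living on windows `(A_j, 0]`; for Type-II blow-up the rescaled solutions live on
TWO-SIDED windows `(A_j, B_j)`, `A_j → −∞`, `B_j → +∞`, and the limit is ETERNAL. Three tools:

* `lipschitz_interior_of_memLp` — the uniform space–time Lipschitz bound `max K 8` on the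
  interior window `[A + 1, B) × ℝ³` of a classical solution (`ν = 1`) on `(A, B) × ℝ³`,
  `A + 2 ≤ B`, bounded by `2`, with square-integrable slices (translated unit windows of the
  finite-energy window bound `BoundedPlanarEnergyRegularity.lipschitz_of_memLp_two`, KNSS §4; the
  bound `2` for far-apart times) — the two-sided twin of `lipschitz_up_to_final_time_of_memLp`;
* `lipschitzWith_clamp₂` — clamping the time to `[A + 1, B']` keeps a `2K'`-Lipschitz map on
  `ℝ × ℝ³` (twin of `lipschitzWith_clamp`);
* `exists_eternal_limit` — **eternal extraction**: classical `(V_j, P_j)` (`ν = 1`) on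
  `(A_j, B_j)`, `A_j → −∞`, `B_j → +∞`, `A_j + 2 ≤ B_j`, bounded by `2`, with square-integrable
  slices uniformly bounded in `L²`, have a subsequence converging POINTWISE ON ALL OF `ℝ × ℝ³` to a
  continuous `w`, `‖w‖ ≤ 2`, with weakly divergence-free slices, satisfying the Oseen integral
  identity `w(t) = e^{(t−s)Δ}w(s) − B¹_s(w,w)(t)` for ALL `s < t` (uniform Lipschitz bound + clamp
  + pointwise Arzelà–Ascoli `exists_strictMono_tendsto_of_lipschitzWith`; each `V_j` is Oseen-mild
  on `(A_j, B_j − 1)` by `mild_of_bounded_of_eLpNorm_two_le_of_lt`, and the identity passes to the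
  limit by dominated convergence, `tendsto_heatExtension_of_tendsto_of_bound`,
  `tendsto_oseenDuhamel_of_tendsto_of_bound`);
* `eternal_of_oseen` — such a `w` is a bounded ETERNAL mild solution: every time-shift is a
  bounded ancient mild solution (`ν = 1`, duality form; `zoom_limit_isBoundedAncientMildSolution`
  on the shifts, `oseenDuhamel_translate`), and `w` is jointly `C^∞` on `ℝ × ℝ³` (KNSS §4 on every
  shifted open slab).

HONEST FRAMING: compactness bookkeeping for HYPOTHETICAL rescaled blow-up sequences (other route,
not a pub-ns-dss cell file); nothing here bears on the regularity problem itself.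

References: Koch–Nadirashvili–Seregin–Šverák 2009, §3 Lemma 3.1, §4, §6 Lemma 6.1
(arXiv:0709.3599). [KochNadirashviliSereginSverak2009]
-/

noncomputable section

set_option linter.dupNamespace false

namespace Summit.NavierStokesRegularity.NavierStokesRegularity.Theorems

open MeasureTheory Set Function Filter Topology TopologicalSpace Metric
open scoped NNReal ENNReal ContDiff
open Literature.Analysis Literature.Analysis.FluidPDE

namespace TypeIISlowDoublingEternal

-- adapted from `BoundedPlanarEnergyRegularity.lipschitz_up_to_final_time_of_memLp`
-- (Theorems/PlaneEnergyCeilingBoundedPlanarEnergyRegularityZoomFinalTime.lean), steps (i), (ii), (iv)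
/-- **Uniform Lipschitz bound on an interior two-sided window** (module docstring): if `K` bounds
the space–time Lipschitz modulus on `[1/2, 1) × ℝ³` of every bounded weak solution on
`ℝ³ × (0, 1)` (`ν = 1`), continuous on the open slab, bounded by `2`, with square-integrable
slices, then every classical `(V, P)` (`ν = 1`) on `(A, B) × ℝ³`, `A + 2 ≤ B`, with `‖V‖ ≤ 2` and
`V(s) ∈ L²`, satisfies `‖V(t, x) − V(s, y)‖ ≤ max K 8 · (|t − s| + ‖x − y‖)` for
`s, t ∈ [A + 1, B)`. [cite: KochNadirashviliSereginSverak2009, §4 (4.10)–(4.11) and Lemma 6.1 (arXiv:0709.3599 pp. 8, 11)] -/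
theorem lipschitz_interior_of_memLp :
    ∀ (K : ℝ), (∀ ⦃w : ℝ → EuclideanSpace ℝ (Fin 3) → EuclideanSpace ℝ (Fin 3)⦄,
      IsBoundedWeakNSSolutionOn (Ioo 0 1) isOpen_Ioo 1 w →
      ContinuousOn (uncurry w) (Ioo (0 : ℝ) 1 ×ˢ univ) →
      (∀ t ∈ Ioo (0 : ℝ) 1, ∀ x, ‖w t x‖ ≤ 2) →
      (∀ t ∈ Ioo (0 : ℝ) 1, MemLp (w t) 2 volume) →
      ∀ s ∈ Ico (1 / 2 : ℝ) 1, ∀ t ∈ Ico (1 / 2 : ℝ) 1, ∀ x y : EuclideanSpace ℝ (Fin 3),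
        ‖w t x - w s y‖ ≤ K * (|t - s| + ‖x - y‖)) →
    ∀ (A B : ℝ), A + 2 ≤ B →
    ∀ (V : ℝ → EuclideanSpace ℝ (Fin 3) → EuclideanSpace ℝ (Fin 3))
      (P : ℝ → EuclideanSpace ℝ (Fin 3) → ℝ),
      IsClassicalNSSolutionOn (Ioo A B) 1 0 V P →
      (∀ s ∈ Ioo A B, ∀ y, ‖V s y‖ ≤ 2) →
      (∀ s ∈ Ioo A B, MemLp (V s) 2 volume) →
      ∀ s ∈ Ico (A + 1) B, ∀ t ∈ Ico (A + 1) B, ∀ x y : EuclideanSpace ℝ (Fin 3),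
        ‖V t x - V s y‖ ≤ max K 8 * (|t - s| + ‖x - y‖) := by
  intro K hKprop A B hAB V P hV hbd hL2
  -- (i) the window bound, translated: times in `[σ - 1/2, σ)`, `σ ∈ [A + 1, B]`
  have hwin : ∀ σ ∈ Icc (A + 1) B, ∀ r₁ ∈ Ico (σ - 1 / 2) σ, ∀ r₂ ∈ Ico (σ - 1 / 2) σ,
      ∀ x y : EuclideanSpace ℝ (Fin 3), ‖V r₂ x - V r₁ y‖ ≤ K * (|r₂ - r₁| + ‖x - y‖) := by
    intro σ hσ r₁ hr₁ r₂ hr₂ x y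
    set w : ℝ → EuclideanSpace ℝ (Fin 3) → EuclideanSpace ℝ (Fin 3) :=
      fun τ => V (τ + (σ - 1)) with hw_def
    have hmem : ∀ τ ∈ Ioo (0 : ℝ) 1, τ + (σ - 1) ∈ Ioo A B := fun τ hτ =>
      ⟨by linarith [hτ.1, hσ.1], by linarith [hτ.2, hσ.2]⟩
    have hw : IsClassicalNSSolutionOn (Ioo 0 1) 1
        (fun τ => (0 : ℝ → EuclideanSpace ℝ (Fin 3) → EuclideanSpace ℝ (Fin 3)) (τ + (σ - 1))) w
        (fun τ => P (τ + (σ - 1))) :=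
      (hV.comp_add_right (σ - 1)).mono (fun τ hτ => hmem τ hτ) (uniqueDiffOn_Ioo 0 1)
    have h0 : (fun τ : ℝ =>
        (0 : ℝ → EuclideanSpace ℝ (Fin 3) → EuclideanSpace ℝ (Fin 3)) (τ + (σ - 1))) = 0 := by
      funext τ; rfl
    have hw' : IsClassicalNSSolutionOn (Ioo 0 1) 1 0 w (fun τ => P (τ + (σ - 1))) := by
      rw [h0] at hw; exact hw
    have hwbd : ∀ τ ∈ Ioo (0 : ℝ) 1, ∀ z, ‖w τ z‖ ≤ 2 := fun τ hτ z => hbd _ (hmem τ hτ) z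
    have hweak := hw'.isBoundedWeakNSSolutionOn ⟨2, hwbd⟩
    have hwc : ContinuousOn (uncurry w) (Ioo (0 : ℝ) 1 ×ˢ univ) := hw'.smooth_velocity.continuousOn
    have hwL2 : ∀ τ ∈ Ioo (0 : ℝ) 1, MemLp (w τ) 2 volume := fun τ hτ => hL2 _ (hmem τ hτ)
    have key := hKprop hweak hwc hwbd hwL2 (r₁ - (σ - 1)) ⟨by linarith [hr₁.1], by linarith [hr₁.2]⟩
      (r₂ - (σ - 1)) ⟨by linarith [hr₂.1], by linarith [hr₂.2]⟩ x y
    simp only [hw_def, sub_add_cancel] at key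
    rwa [show r₂ - (σ - 1) - (r₁ - (σ - 1)) = r₂ - r₁ by ring] at key
  -- (ii) pairs of times at distance `< 1/2`
  have hclose : ∀ s ∈ Ico (A + 1) B, ∀ t ∈ Ico (A + 1) B, |t - s| < 1 / 2 →
      ∀ x y : EuclideanSpace ℝ (Fin 3), ‖V t x - V s y‖ ≤ K * (|t - s| + ‖x - y‖) := by
    intro s hs t ht hts x y
    have hts' := abs_lt.1 hts
    set σ : ℝ := min B (min s t + 1 / 2) with hσ
    have hσA : σ ∈ Icc (A + 1) B := by
      refine ⟨le_min (by linarith) ?_, min_le_left _ _⟩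
      have := min_le_min hs.1 ht.1
      rw [min_self] at this
      linarith
    refine hwin σ hσA s ⟨?_, ?_⟩ t ⟨?_, ?_⟩ x y
    · have h1 : σ ≤ min s t + 1 / 2 := min_le_right _ _
      have h2 : min s t ≤ s := min_le_left _ _
      linarith
    · refine lt_min hs.2 ?_
      rcases le_total s t with h | h
      · rw [min_eq_left h]; linarith
      · rw [min_eq_right h]; linarith
    · have h1 : σ ≤ min s t + 1 / 2 := min_le_right _ _
      have h2 : min s t ≤ t := min_le_right _ _
      linarith
    · refine lt_min ht.2 ?_
      rcases le_total s t with h | h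
      · rw [min_eq_left h]; linarith
      · rw [min_eq_right h]; linarith
  -- (iii) far-apart times by the bound `2`
  intro s hs t ht x y
  have hKle : K ≤ max K 8 := le_max_left _ _
  have hsum0 : 0 ≤ |t - s| + ‖x - y‖ := by positivity
  by_cases hts : |t - s| < 1 / 2
  · exact (hclose s hs t ht hts x y).trans (mul_le_mul_of_nonneg_right hKle hsum0)
  · have h1 : ‖V t x‖ ≤ 2 := hbd t ⟨by linarith [ht.1], ht.2⟩ x
    have h2 : ‖V s y‖ ≤ 2 := hbd s ⟨by linarith [hs.1], hs.2⟩ y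
    have h3 : 1 / 2 ≤ |t - s| := not_lt.1 hts
    calc ‖V t x - V s y‖ ≤ ‖V t x‖ + ‖V s y‖ := norm_sub_le _ _
      _ ≤ 8 * (|t - s| + ‖x - y‖) := by nlinarith [norm_nonneg (x - y)]
      _ ≤ max K 8 * (|t - s| + ‖x - y‖) := mul_le_mul_of_nonneg_right (le_max_right _ _) hsum0

-- adapted from `lipschitzWith_clamp` (Literature/Analysis/FluidPDE/KNSSTypeIIZoomIn.lean)
/-- **Two-sided clamp.** If `‖V(t, x) − V(s, y)‖ ≤ K' (|t − s| + ‖x − y‖)` for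
`s, t ∈ [A + 1, B']` (`A + 1 ≤ B'`, `K' ≥ 0`), then `(t, x) ↦ V(max(A + 1, min(t, B')), x)` is
`2K'`-Lipschitz on `ℝ × ℝ³`. [folklore] -/
theorem lipschitzWith_clamp₂ {K' A B' : ℝ} (hK' : 0 ≤ K') (hA : A + 1 ≤ B')
    {V : ℝ → EuclideanSpace ℝ (Fin 3) → EuclideanSpace ℝ (Fin 3)}
    (hLip : ∀ s ∈ Icc (A + 1) B', ∀ t ∈ Icc (A + 1) B', ∀ x y : EuclideanSpace ℝ (Fin 3),
      ‖V t x - V s y‖ ≤ K' * (|t - s| + ‖x - y‖)) :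
    LipschitzWith (Real.toNNReal (2 * K'))
      (fun z : ℝ × EuclideanSpace ℝ (Fin 3) => V (max (A + 1) (min z.1 B')) z.2) := by
  refine LipschitzWith.of_dist_le_mul fun z z' => ?_
  have hcl : ∀ r : ℝ, max (A + 1) (min r B') ∈ Icc (A + 1) B' := fun r =>
    ⟨le_max_left _ _, max_le hA (min_le_right _ _)⟩
  have hcl1 : |max (A + 1) (min z.1 B') - max (A + 1) (min z'.1 B')| ≤ |z.1 - z'.1| := by
    refine (abs_max_sub_max_le_max _ _ _ _).trans ?_
    rw [sub_self, abs_zero]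
    refine max_le (abs_nonneg _) ((abs_min_sub_min_le_max _ _ _ _).trans ?_)
    rw [sub_self, abs_zero, max_eq_left (abs_nonneg _)]
  rw [dist_eq_norm, Real.coe_toNNReal _ (by positivity)]
  have h1 := hLip _ (hcl z'.1) _ (hcl z.1) z.2 z'.2
  have h2 : |z.1 - z'.1| ≤ dist z z' := by
    rw [← Real.dist_eq, Prod.dist_eq]; exact le_max_left _ _
  have h3 : ‖z.2 - z'.2‖ ≤ dist z z' := by
    rw [← dist_eq_norm, Prod.dist_eq]; exact le_max_right _ _
  calc ‖V (max (A + 1) (min z.1 B')) z.2 - V (max (A + 1) (min z'.1 B')) z'.2‖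
      ≤ K' * (|max (A + 1) (min z.1 B') - max (A + 1) (min z'.1 B')| + ‖z.2 - z'.2‖) := h1
    _ ≤ K' * (dist z z' + dist z z') := by gcongr; exact hcl1.trans h2
    _ = 2 * K' * dist z z' := by ring

/-- **Eternal extraction** (module docstring): classical `(V_j, P_j)` (`ν = 1`) on `(A_j, B_j)`,
`A_j → −∞`, `B_j → +∞`, `A_j + 2 ≤ B_j`, bounded by `2`, with square-integrable slices uniformly
bounded in `L²`, have a subsequence converging pointwise on `ℝ × ℝ³` to a continuous `w` with
`‖w‖ ≤ 2`, weakly divergence-free slices, and the Oseen identity between ALL pairs `s < t`.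
[cite: KochNadirashviliSereginSverak2009, §6 Lemma 6.1 and §3 Lemma 3.1 (arXiv:0709.3599 pp. 7, 11)] -/
theorem exists_eternal_limit {A B : ℕ → ℝ}
    {V : ℕ → ℝ → EuclideanSpace ℝ (Fin 3) → EuclideanSpace ℝ (Fin 3)}
    {P : ℕ → ℝ → EuclideanSpace ℝ (Fin 3) → ℝ}
    (hAtend : Tendsto A atTop atBot) (hBtend : Tendsto B atTop atTop) (hAB : ∀ j, A j + 2 ≤ B j)
    (hVcl : ∀ j, IsClassicalNSSolutionOn (Ioo (A j) (B j)) 1 0 (V j) (P j))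
    (hVbd : ∀ j, ∀ s ∈ Ioo (A j) (B j), ∀ y, ‖V j s y‖ ≤ 2)
    (hVL2 : ∀ j, ∀ s ∈ Ioo (A j) (B j), MemLp (V j s) 2 volume)
    (hVK : ∀ j, ∃ K : ℝ≥0∞, K ≠ ⊤ ∧ ∀ s ∈ Ioo (A j) (B j), eLpNorm (V j s) 2 volume ≤ K) :
    ∃ (φ : ℕ → ℕ) (w : ℝ → EuclideanSpace ℝ (Fin 3) → EuclideanSpace ℝ (Fin 3)),
      StrictMono φ ∧ Continuous (uncurry w) ∧ (∀ t x, ‖w t x‖ ≤ 2) ∧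
      (∀ t x, Tendsto (fun j => V (φ j) t x) atTop (𝓝 (w t x))) ∧
      (∀ t, IsWeaklyDivFree (w t)) ∧
      (∀ s t : ℝ, s < t → ∀ x,
        w t x = UnboundedOperators.heatExtension (w s) (t - s) x - oseenDuhamel 1 s w w t x) := by
  obtain ⟨K, hK0, hKprop⟩ := BoundedPlanarEnergyRegularity.lipschitz_of_memLp_two 2
  have hK8 : 0 ≤ max K 8 := hK0.trans (le_max_left _ _)
  have hLip : ∀ j, ∀ s ∈ Ico (A j + 1) (B j), ∀ t ∈ Ico (A j + 1) (B j),
      ∀ x y : EuclideanSpace ℝ (Fin 3), ‖V j t x - V j s y‖ ≤ max K 8 * (|t - s| + ‖x - y‖) :=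
    fun j => lipschitz_interior_of_memLp K hKprop (A j) (B j) (hAB j) (V j) (P j) (hVcl j)
      (hVbd j) (hVL2 j)
  -- the clamped maps and the extraction
  set W : ℕ → ℝ × EuclideanSpace ℝ (Fin 3) → EuclideanSpace ℝ (Fin 3) :=
    fun j z => V j (max (A j + 1) (min z.1 (B j - 1))) z.2 with hWdef
  have hWlip : ∀ j, LipschitzWith (Real.toNNReal (2 * max K 8)) (W j) := fun j =>
    lipschitzWith_clamp₂ hK8 (by linarith [hAB j]) fun s hs t ht x y =>
      hLip j s ⟨hs.1, by linarith [hs.2]⟩ t ⟨ht.1, by linarith [ht.2]⟩ x y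
  have hclamp : ∀ j (r : ℝ), max (A j + 1) (min r (B j - 1)) ∈ Ioo (A j) (B j) := fun j r =>
    ⟨by linarith [le_max_left (A j + 1) (min r (B j - 1))],
      lt_of_le_of_lt (max_le (by linarith [hAB j]) (min_le_right _ _)) (by linarith)⟩
  have hWball : ∀ j z, W j z ∈ closedBall (0 : EuclideanSpace ℝ (Fin 3)) 2 := fun j z =>
    mem_closedBall_zero_iff.2 (hVbd j _ (hclamp j z.1) z.2)
  obtain ⟨φ, Winf, hφ, hWinflip, hWinfball, hWconv⟩ :=
    exists_strictMono_tendsto_of_lipschitzWith W hWlip hWball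
  have hAφ : Tendsto (fun m => A (φ m)) atTop atBot := hAtend.comp hφ.tendsto_atTop
  have hBφ : Tendsto (fun m => B (φ m)) atTop atTop := hBtend.comp hφ.tendsto_atTop
  have hevA : ∀ t : ℝ, ∀ᶠ m in atTop, A (φ m) + 1 ≤ t := fun t =>
    (hAφ.eventually (eventually_le_atBot (t - 1))).mono fun m hm => by linarith
  have hevB : ∀ t : ℝ, ∀ᶠ m in atTop, t ≤ B (φ m) - 1 := fun t =>
    (hBφ.eventually (eventually_ge_atTop (t + 1))).mono fun m hm => by linarith
  have hVlim : ∀ t x, Tendsto (fun m => V (φ m) t x) atTop (𝓝 (Winf (t, x))) := by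
    intro t x
    refine (hWconv (t, x)).congr' ?_
    filter_upwards [hevA t, hevB t] with m hmA hmB
    show V (φ m) (max (A (φ m) + 1) (min t (B (φ m) - 1))) x = V (φ m) t x
    rw [min_eq_left hmB, max_eq_right hmA]
  have hwcont : Continuous (uncurry fun t x => Winf (t, x)) := hWinflip.continuous
  have hwbd : ∀ t x, ‖Winf (t, x)‖ ≤ 2 := fun t x => mem_closedBall_zero_iff.1 (hWinfball (t, x))
  -- slices of the rescaled solutions
  have hVslice : ∀ j, ∀ s ∈ Ioo (A j) (B j), Continuous (V j s) := fun j s hs =>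
    ((hVcl j).contDiff_velocity hs).continuous
  have hVdiv : ∀ j, ∀ s ∈ Ioo (A j) (B j), IsWeaklyDivFree (V j s) := fun j s hs =>
    VectorCalculus.IsDivFree.isWeaklyDivFree_holds ((hVcl j).divFree s hs)
      (contDiff_infty.1 ((hVcl j).contDiff_velocity hs) 1)
  -- for a fixed pair `s < t`, the tail of the subsequence sees `[s, t]` inside `(A + 1, B - 1)`
  have htail : ∀ s t : ℝ, ∃ N : ℕ, ∀ m, N ≤ m → A (φ m) + 1 ≤ s ∧ t ≤ B (φ m) - 1 := fun s t =>
    eventually_atTop.1 ((hevA s).and (hevB t))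
  -- weak divergence-freeness of the limit slices
  have hdivw : ∀ t, IsWeaklyDivFree fun x => Winf (t, x) := by
    intro t
    obtain ⟨N, hN⟩ := htail t t
    have hmem : ∀ k, t ∈ Ioo (A (φ (k + N))) (B (φ (k + N))) := fun k => by
      obtain ⟨h1, h2⟩ := hN (k + N) (Nat.le_add_left N k)
      exact ⟨by linarith, by linarith⟩
    exact BoundedPlanarEnergyRegularity.isWeaklyDivFree_of_tendsto_of_bound
      (a := fun k => V (φ (k + N)) t) (M := 2) (fun k => hVdiv _ t (hmem k))
      (fun k => hVslice _ t (hmem k)) (fun k x => hVbd _ t (hmem k) x)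
      (fun x => (hVlim t x).comp (tendsto_add_atTop_nat N))
  -- the Oseen identity in the limit
  have hmild : ∀ s t : ℝ, s < t → ∀ x, Winf (t, x) =
      UnboundedOperators.heatExtension (fun y => Winf (s, y)) (t - s) x -
        oseenDuhamel 1 s (fun τ y => Winf (τ, y)) (fun τ y => Winf (τ, y)) t x := by
    intro s t hst x
    obtain ⟨N, hN⟩ := htail s (t + 1)
    have hAk : ∀ k, A (φ (k + N)) < s := fun k => by
      have := (hN (k + N) (Nat.le_add_left N k)).1; linarith
    have hBk : ∀ k, t < B (φ (k + N)) - 1 := fun k => by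
      have := (hN (k + N) (Nat.le_add_left N k)).2; linarith
    have hmildV : ∀ k, V (φ (k + N)) t x =
        UnboundedOperators.heatExtension (V (φ (k + N)) s) (t - s) x -
          oseenDuhamel 1 s (V (φ (k + N))) (V (φ (k + N))) t x := fun k => by
      obtain ⟨Kk, hKtop, hKb⟩ := hVK (φ (k + N))
      exact mild_of_bounded_of_eLpNorm_two_le_of_lt (hVcl _) (T := B (φ (k + N)) - 1)
        (by linarith [hAB (φ (k + N))]) (by linarith)
        (fun r hr y => hVbd _ r ⟨hr.1, by linarith [hr.2]⟩ y) hKtop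
        (fun r hr => hKb r ⟨hr.1, by linarith [hr.2]⟩) (hAk k) hst (hBk k) x
    have hsmem : ∀ k, s ∈ Ioo (A (φ (k + N))) (B (φ (k + N))) := fun k =>
      ⟨hAk k, hst.trans ((hBk k).trans (by linarith))⟩
    have hL : Tendsto (fun k => V (φ (k + N)) t x) atTop (𝓝 (Winf (t, x))) :=
      (hVlim t x).comp (tendsto_add_atTop_nat N)
    have hH : Tendsto (fun k => UnboundedOperators.heatExtension (V (φ (k + N)) s) (t - s) x) atTop
        (𝓝 (UnboundedOperators.heatExtension (fun y => Winf (s, y)) (t - s) x)) :=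
      tendsto_heatExtension_of_tendsto_of_bound (M := 2)
        (fun k => (hVslice _ s (hsmem k)).aestronglyMeasurable) (fun k z => hVbd _ s (hsmem k) z)
        (fun z => (hVlim s z).comp (tendsto_add_atTop_nat N)) (sub_pos.2 hst) x
    have hmeasV : ∀ k, AEStronglyMeasurable (uncurry (V (φ (k + N))))
        ((volume : Measure (ℝ × EuclideanSpace ℝ (Fin 3))).restrict (Ioo s t ×ˢ univ)) := fun k =>
      (((hVcl _).smooth_velocity.continuousOn).mono (prod_mono
        (Ioo_subset_Ioo (hAk k).le ((hBk k).le.trans (by linarith))) Subset.rfl)).aestronglyMeasurable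
        (measurableSet_Ioo.prod MeasurableSet.univ)
    have hmeasW : AEStronglyMeasurable (uncurry fun τ y => Winf (τ, y))
        ((volume : Measure (ℝ × EuclideanSpace ℝ (Fin 3))).restrict (Ioo s t ×ˢ univ)) :=
      hwcont.aestronglyMeasurable
    have hD : Tendsto (fun k => oseenDuhamel 1 s (V (φ (k + N))) (V (φ (k + N))) t x) atTop
        (𝓝 (oseenDuhamel 1 s (fun τ y => Winf (τ, y)) (fun τ y => Winf (τ, y)) t x)) :=
      tendsto_oseenDuhamel_of_tendsto_of_bound one_pos zero_le_two hst hmeasV hmeasW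
        (fun k τ hτ y => hVbd _ τ ⟨(hAk k).trans hτ.1, hτ.2.trans ((hBk k).trans (by linarith))⟩ y)
        (fun τ _ y => (hVlim τ y).comp (tendsto_add_atTop_nat N)) x
    have hR : Tendsto (fun k => V (φ (k + N)) t x) atTop
        (𝓝 (UnboundedOperators.heatExtension (fun y => Winf (s, y)) (t - s) x -
          oseenDuhamel 1 s (fun τ y => Winf (τ, y)) (fun τ y => Winf (τ, y)) t x)) :=
      (hH.sub hD).congr fun k => (hmildV k).symm
    exact tendsto_nhds_unique hL hR
  exact ⟨φ, fun t x => Winf (t, x), hφ, hwcont, hwbd, hVlim, hdivw, hmild⟩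

/-- **A bounded continuous eternal Oseen-mild field is a bounded ETERNAL mild solution, jointly
smooth**: `w` continuous on `ℝ × ℝ³`, `‖w‖ ≤ 2`, weakly divergence-free slices, the Oseen identity
for all `s < t` ⇒ every time-shift `w(· + s₀)` is a bounded ancient mild solution (`ν = 1`,
duality form) and `w ∈ C^∞(ℝ × ℝ³)` (KNSS 2009, §4 Prop. 4.1 on every shifted open slab).
[cite: KochNadirashviliSereginSverak2009, §4 Prop. 4.1 and Remark 4.1 (arXiv:0709.3599 p. 8)] -/
theorem eternal_of_oseen {w : ℝ → EuclideanSpace ℝ (Fin 3) → EuclideanSpace ℝ (Fin 3)}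
    (hwc : Continuous (uncurry w)) (hwbd : ∀ t x, ‖w t x‖ ≤ 2)
    (hdiv : ∀ t, IsWeaklyDivFree (w t))
    (hmild : ∀ s t : ℝ, s < t → ∀ x,
      w t x = UnboundedOperators.heatExtension (w s) (t - s) x - oseenDuhamel 1 s w w t x) :
    (∀ s₀ : ℝ, IsBoundedAncientMildSolution 1 (fun s y => w (s + s₀) y)) ∧
      ContDiff ℝ (⊤ : ℕ∞) (uncurry w) := by
  have hshift : ∀ s₀ : ℝ, IsBoundedAncientMildSolution 1 (fun s => w (s + s₀)) ∧
      ContDiffOn ℝ (⊤ : ℕ∞) (uncurry fun s => w (s + s₀)) (Iio 0 ×ˢ univ) := by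
    intro s₀
    have hc : Continuous (uncurry fun s => w (s + s₀)) :=
      hwc.comp ((continuous_fst.add continuous_const).prodMk continuous_snd)
    have h := BoundedPlanarEnergyRegularity.zoom_limit_isBoundedAncientMildSolution
      (fun s => w (s + s₀)) hc (fun t _ x => hwbd _ x) (fun t _ => hdiv _)
      (fun s t x hst _ => by
        have h1 := hmild (s + s₀) (t + s₀) (by linarith) x
        rw [show t + s₀ - (s + s₀) = t - s by ring] at h1
        rw [h1, oseenDuhamel_translate])
    exact ⟨h.1, h.2.1⟩
  refine ⟨fun s₀ => (hshift s₀).1, ?_⟩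
  rw [contDiff_iff_contDiffAt]
  rintro ⟨t, x⟩
  have hAt : ContDiffAt ℝ (⊤ : ℕ∞) (uncurry fun s => w (s + (t + 1))) (-1, x) :=
    (hshift (t + 1)).2.contDiffAt ((isOpen_Iio.prod isOpen_univ).mem_nhds ⟨by norm_num, mem_univ _⟩)
  have hcomp : uncurry w = (uncurry fun s => w (s + (t + 1))) ∘
      fun p : ℝ × EuclideanSpace ℝ (Fin 3) => (p.1 - (t + 1), p.2) := by
    funext p
    simp only [Function.comp_apply, uncurry, sub_add_cancel]
  rw [hcomp]
  have hf : ContDiffAt ℝ (⊤ : ℕ∞)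
      (fun p : ℝ × EuclideanSpace ℝ (Fin 3) => (p.1 - (t + 1), p.2)) (t, x) :=
    ((contDiff_fst.sub contDiff_const).prodMk contDiff_snd).contDiffAt
  have hy : ((t, x) : ℝ × EuclideanSpace ℝ (Fin 3)).1 - (t + 1) = -1 := by
    show t - (t + 1) = -1
    ring
  refine ContDiffAt.comp (t, x) ?_ hf
  show ContDiffAt ℝ (⊤ : ℕ∞) (uncurry fun s => w (s + (t + 1)))
    (((t, x) : ℝ × EuclideanSpace ℝ (Fin 3)).1 - (t + 1), ((t, x) : ℝ × EuclideanSpace ℝ (Fin 3)).2)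
  rw [hy]
  exact hAt

end TypeIISlowDoublingEternal

end Summit.NavierStokesRegularity.NavierStokesRegularity.Theorems

end
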